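/-
Copyright (c) 2026 the pub-hodgecm-mathlib formalisation cell (harness21).  Prover seat hodgecm-mathlib-K2E2-p01 (g0),
Track B «K2-LIT» ∕ h413, engine E2 «ThetaExhaustionByRigidity», unit ADM-REP, file #1: payment of the socket
`K2E2ThetaExhaustionByRigidity.AdmRep.sig_K2E2AdmLocFNeOneFinite` — THE LOCAL NORM CLASSES OF A LINE ARE TRIVIAL ALMOST EVERYWHERE.  2026-09-03.
-/
import Literature.NumberTheory.Automorphic.Liu2021.Def411WeilCarriers              -- ★ `Eps`, `locF`, `locF_apply` ([Liu2021, Def. 4.11 ∕ 4.12] carriers)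
import Literature.NumberTheory.GelbartRogawski1991.UnitaryDualPairThetaKernelCM    -- ★ `imagUnit`, `imagUnitSq`, `imagUnit_ne_zero`, `imagUnit_mul_self`
import Literature.NumberTheory.QuadraticForms.NormIndexSecondInequalityProofs      -- ★ `OMeara65.mem_quadraticNormSubgroup_of_valued_eq_one`, `finite_setOf_two_mem`
import HarnessLib

/-!
# K2_E2 road (h413 = stmt-HodgeConjecture-24833), unit ADM-REP, file #1:
# the local norm classes `[a]_v ∈ L⁺_vˣ ⧸ N(L_vˣ)` of a line `a ∈ (L⁺)ˣ` are `1` at all but finitely many finite places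

Cell `pub/hodgecm-mathlib` (D-0151), Track B (21-frontier RULING «PUSH BOTH» 2026-09-03, director req621∕req624, chair K2-lead
ORDER #1 §4.4 ∕ ORDER #2, SKELETON LANDED K2E2 2026-09-03T21:02:16Z), socket module
`Summits/HodgeConjecture/HodgeConjecture/Cruxes/H413/Lines/K2_E2_ThetaExhaustionByRigidity_AdmRep.lean` (planner K2E2-plan (g0),
sha16 0ce0c102f00b9ca4), socket **`sig_K2E2AdmLocFNeOneFinite`** (#1, size S, first rung of the chain
ADM-1 + ADM-2 → ADM-3 → ADM-4 = tier-0 `StubAdmissibleRepresentative`): the E3♭ parity hypothesis is phrased with `Set.ncard`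
(junk value `0` on an infinite set) while ★ `isAdmissible_epsOf_iff_even` wants `Set.Finite` — this file supplies the finiteness.

THE MATHEMATICS [Omeara1963, §63B Example 63:12, §65A Example 65:4; §71 Thm. 71:18 (first assertion)].  `L` a CM field,
`L⁺ = maximalRealSubfield L`, `δ = imagUnit L`, `d = imagUnitSq L = δ² ∈ L⁺ ∖ {0}`; for `a ∈ (L⁺)ˣ` and a finite place `v` of `L⁺` the class
★ `locF L⁺ d a v` is the image of `a` in `L⁺_vˣ ⧸ N_v`, `N_v = {x² − d y²} =` ★ `quadraticNormSubgroup (L⁺_v) d` (the norm group of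
`L_v = L⁺_v(√d)`).  ROAD TAKEN HERE (the «unramified computation of the local norm class» of the socket's PLAN): at every place `v` with
`v ∤ 2`, `v(d) = 0` and `v(a) = 0` — all but finitely many, since a non-zero field element is a `v`-unit for almost all `v` (Mathlib
`FiniteAdeleRing.isUnit_iff` on the principal finite adèle, i.e. `HeightOneSpectrum.Support.finite`) and only finitely many `v` divide `2`
(★ `OMeara65.finite_setOf_two_mem`) — the unit `a` IS a local norm from the unramified extension `L⁺_v(√d)` (O'Meara 63:12 ∕ 65:4:
`(a, d)_v = 1` for `v`-units at non-dyadic `v`, ★ `OMeara65.mem_quadraticNormSubgroup_of_valued_eq_one`), so `[a]_v = 1`.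
This road is INDEPENDENT of the Hilbert-reciprocity road (★ `QuadraticForms.hilbertReciprocity_holds`, O'Meara 71:18) by which the
letter-identical tier-0 stub E3fin of the P2 E3-recut was paid (★ `F0P2fStubEPE3finGlobalEps.stubE3fin_holds` ∕ ★ `locF_ne_one_finite`);
either theorem re-ties the socket, this file is the BY-NAME payment the K2E2 table asks for and imports neither.

* §1 generic core over any number field `F` and any `d ≠ 0`: `eventually_valuation_eq_one` (a non-zero `x ∈ F` is a `v`-unit for almost
  all `v`), `locF_eq_one_of_valuation_eq_one` (pointwise: `[a]_v = 1` at a non-dyadic `v` where `d` and `a` are units),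
  `finite_setOf_locF_ne_one` (cofinite assembly);
* §2 the head **`admLocFNeOneFinite`** — `sig_K2E2AdmLocFNeOneFinite` TOKEN FOR TOKEN, `finite_setOf_locF_ne_one` at `F := L⁺`,
  `d := imagUnitSq L = δ·δ ≠ 0` (★ `imagUnit_ne_zero`, ★ `imagUnit_mul_self`; the standalone form of `δ² ≠ 0` is ★
  `F0P2fStubEPE3finGlobalEps.imagUnitSq_ne_zero'`, not re-declared here)
  (by-name tie `example : type_of% @admLocFNeOneFinite = type_of% @K2E2ThetaExhaustionByRigidity.AdmRep.sig_K2E2AdmLocFNeOneFinite := rfl`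
  checked at home by paste, and by import once the socket module is BUILT).

HONEST LABEL.  HC_CM is proved only modulo the 7 printed citations (2 remaining named inputs: hLiu418 = `stmt-HodgeConjecture-24832`, h413 =
`stmt-HodgeConjecture-24833`) until rung 0 closes; this file is a `--supports stmt-HodgeConjecture-24833 --as helper` payment and moves no counter.

## References
* [Omeara1963] O. T. O'Meara, *Introduction to Quadratic Forms*, Grundlehren 117, Springer (1963) — §63B Example 63:12 (units are norms
  from an unramified quadratic extension at a non-dyadic spot), §65A Examples 65:1, 65:4, §71 Thm. 71:18 (first assertion: `(α, β)_𝔭 = 1`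
  for almost all `𝔭`).
* [Liu2021] Y. Liu, *Fourier–Jacobi cycles and arithmetic relative trace formula*, Camb. J. Math. 9 (2021) = arXiv:2102.11518 —
  Def. 4.11 (l. 2083–2097: «`ε_v ∈ O_{E_v}^× Nm E_v^×` for all but finitely many `v`»), Def. 4.12 (l. 2102–2108).
-/

set_option autoImplicit false
-- the mandated namespace repeats the single-problem summit's segment (`HodgeConjecture.HodgeConjecture`)
set_option linter.dupNamespace false

noncomputable section

open NumberField IsDedekindDomain

namespace Summit.HodgeConjecture.HodgeConjecture.Cruxes.H413.K2E2AdmLocFNeOneFinite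

open Literature.NumberTheory Literature.NumberTheory.Automorphic
open Literature.NumberTheory.Automorphic.Liu2021 Literature.NumberTheory.Automorphic.Liu2021.Def411WeilCarriers
open Literature.NumberTheory.GelbartRogawski1991 Literature.NumberTheory.GelbartRogawski1991.UnitaryDualPair
open Literature.NumberTheory.QuadraticForms Literature.NumberTheory.QuadraticForms.OMeara65

/-! ## §1 Generic core: a global unit class is trivial at every good place, and almost every place is good -/

section Generic

variable {F : Type} [Field F] [NumberField F]

/-- **a non-zero field element is a local unit almost everywhere**: for `x ≠ 0` in a number field `F`, `v(x) = 0` (multiplicatively: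
`v.valuation F x = 1`) for all but finitely many finite places `v` — the principal finite adèle of `x` is a unit of `𝔸_{F,f}`
(Mathlib `FiniteAdeleRing.isUnit_iff`, resting on `HeightOneSpectrum.Support.finite`). [folklore] -/
theorem eventually_valuation_eq_one {x : F} (hx : x ≠ 0) :
    ∀ᶠ v : HeightOneSpectrum (𝓞 F) in Filter.cofinite, v.valuation F x = 1 := by
  have hu : IsUnit (algebraMap F (FiniteAdeleRing (𝓞 F) F) x) := (isUnit_iff_ne_zero.2 hx).map _
  filter_upwards [(FiniteAdeleRing.isUnit_iff.1 hu).2] with v hv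
  rw [← GaloisRepresentations.valued_algebraMap_adicCompletion]
  exact hv

/-- **the unramified computation of the local norm class** (O'Meara 63:12 ∕ 65:4): at a non-dyadic finite place `v` of `F` where
`d` and `a` are both `v`-units, the class of `a` in `F_vˣ ⧸ N(F_v(√d)ˣ)` is trivial — units are norms from the unramified quadratic
extension (★ `OMeara65.mem_quadraticNormSubgroup_of_valued_eq_one`). [cite: Omeara1963, §63B Example 63:12; §65A Example 65:4] -/
theorem locF_eq_one_of_valuation_eq_one {d : F} (a : Fˣ) (v : HeightOneSpectrum (𝓞 F)) (h2 : (2 : 𝓞 F) ∉ v.asIdeal)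
    (hd : v.valuation F d = 1) (ha : v.valuation F (a : F) = 1) : locF F d a v = 1 := by
  rw [locF_apply, QuotientGroup.eq_one_iff]
  refine mem_quadraticNormSubgroup_of_valued_eq_one v h2 hd ?_
  change Valued.v (algebraMap F (v.adicCompletion F) (a : F)) = 1
  rw [GaloisRepresentations.valued_algebraMap_adicCompletion, ha]

/-- **the local norm classes of a global `a ∈ Fˣ` are trivial almost everywhere** (any number field `F`, any `d ≠ 0`):
`{v | locF F d a v ≠ 1}` is finite — it lies in the finite union of the dyadic places (★ `OMeara65.finite_setOf_two_mem`), the places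
where `d` is not a unit and the places where `a` is not a unit (`eventually_valuation_eq_one`), by `locF_eq_one_of_valuation_eq_one`.
This is the first assertion of O'Meara's Thm. 71:18 («their Hilbert symbol is `1` for almost all `𝔭`») for the pair `(a, d)`, reached
WITHOUT reciprocity. [cite: Omeara1963, §65A Example 65:4; §71 Thm. 71:18 (first assertion)] [cite: Liu2021, Def. 4.11 (l. 2088)] -/
theorem finite_setOf_locF_ne_one {d : F} (hd : d ≠ 0) (a : Fˣ) :
    {v : HeightOneSpectrum (𝓞 F) | locF F d a v ≠ 1}.Finite := by
  have he2 : ∀ᶠ v : HeightOneSpectrum (𝓞 F) in Filter.cofinite, (2 : 𝓞 F) ∉ v.asIdeal :=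
    Filter.eventually_cofinite.2 (by simpa only [not_not] using finite_setOf_two_mem (K := F))
  have h : ∀ᶠ v : HeightOneSpectrum (𝓞 F) in Filter.cofinite, locF F d a v = 1 :=
    (he2.and ((eventually_valuation_eq_one hd).and (eventually_valuation_eq_one a.ne_zero))).mono
      fun v hv => locF_eq_one_of_valuation_eq_one a v hv.1 hv.2.1 hv.2.2
  exact Filter.eventually_cofinite.1 h

end Generic

/-! ## §2 The CM line: `F = L⁺`, `d = δ² = imagUnitSq L` — the head -/

/-- **PAYMENT OF `sig_K2E2AdmLocFNeOneFinite`** (socket #1 of unit ADM-REP of the K2_E2 road,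
`Cruxes/H413/Lines/K2_E2_ThetaExhaustionByRigidity_AdmRep.lean`, TOKEN FOR TOKEN): for a CM field `L` and a line `a ∈ (L⁺)ˣ` the
collection `locF L⁺ (δ_L²) a : v ↦ [a]_v ∈ L⁺_vˣ ⧸ N(L_vˣ)` is `1` outside a finite set of finite places — `finite_setOf_locF_ne_one` at
`F := L⁺`, `d := imagUnitSq L = δ·δ ≠ 0` (`δ = imagUnit L ≠ 0`, ★ `imagUnit_ne_zero` ∕ ★ `imagUnit_mul_self`; unramified-unit road,
O'Meara 63:12 ∕ 65:4 — the bad set sits inside the places above `2·a·δ_L²`).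
[cite: Omeara1963, §65A Example 65:4; §71 Thm. 71:18 (first assertion)] [cite: Liu2021, Def. 4.11 (l. 2090–2096)] -/
theorem admLocFNeOneFinite :
    ∀ (L : Type) [Field L] [NumberField L] [IsCMField L] (a : (↥(maximalRealSubfield L))ˣ),
      {v : HeightOneSpectrum (𝓞 ↥(maximalRealSubfield L)) |
          locF (↥(maximalRealSubfield L)) (imagUnitSq L) a v ≠ 1}.Finite := by
  intro L _ _ _ a
  -- `δ·δ ≠ 0` in `L⁺`, read through `L⁺ ↪ L`
  have hd : imagUnitSq L ≠ 0 := fun h =>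
    imagUnit_ne_zero L (mul_self_eq_zero.1 (by rw [imagUnit_mul_self, h, map_zero]))
  exact finite_setOf_locF_ne_one hd a

end Summit.HodgeConjecture.HodgeConjecture.Cruxes.H413.K2E2AdmLocFNeOneFinite

end
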